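import Mathlib
import HarnessLib

/-!
# Survival of the graph 3-torus `Γ_I ⊂ E_ω⁶` along the Weil family: the cell keeps only the
# (2,2)-hyperbolic-block remnant of the `X × X̂` structure (WEIL-2 gen 25, LIMITS-G25 §3.4 (G))

research route, not a corollary; conditional on HC_CM plus one named minimal statement.

Cell `pub-hodge-ring2-ab-*` (ALL ABELIAN VARIETIES), seat WEIL-2 gen 25, §3.4 (G) of
`run/shared/lean/pub/pub-hodge-ring2/pub-hodge-ring2-ab-weil-2/LIMITS-G25.md`.

Informal setting (not formalised).  On `Y₀ = E_ω⁶` a direction of the Weil family is `k_X = [[0, X], [Y, 0]]` with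
`Y = d₋⁻¹ Xᵀ d₊`; the graph `Γ_g = {(x, g x)}` of `g : E₊³ → E₋³` survives `κ_X` to first order iff `Y = g X ḡ`.  For the
graph of the identity (`Γ_I = Δ₀₃ × Δ₁₄ × Δ₂₅`, Markman's «`X`» inside `X × X̂` on the split side) and plus-weights
`d₊ = (d_a)`, minus-weights `d₋ = (d′_b)`, the equation reads entrywise `d′_b X_{ba} = d_a X_{ab}`.  This file proves:

* `weightDefect_mul_entry_eq_zero` — the survival equation forces `(d_a d_b − d′_a d′_b) · X_{ab} = 0` for all `a, b`
  (apply the equation twice);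
* `cell_graphSurvival_iff` — for the cell (`d₊ = (1,1,1)`, `d₋ = (1,1,2)`, any field of characteristic zero) the
  solutions are exactly the `X` with vanishing third row and column and symmetric `{0,1}`-block: a 3-dimensional space
  (`⟨E₀₀, E₁₁, E₀₁ + E₁₀⟩ = ⟨κ₀₃, κ₁₄, κ₀₄ + κ₁₃⟩` in the account), versus all symmetric `X` (dimension 6, the
  `X × X̂`-type locus) for the split sibling — `split_graphSurvival_iff`.

These are the hand proofs behind the first and seventh rows of the engine table of LIMITS-G25 §3.4 (survival dimension of
`Γ_I`: 3 in the cell, 6 in the split form).  0 sorry, no `def`, no named fact; `HC_CM` does not occur.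

## References

* [vanGeemen1994HodgeAV] B. van Geemen, An introduction to the Hodge conjecture for abelian varieties, LNM 1594, §5 —
  the tangent space of a Weil-type family (context only).
-/

namespace Summit.HodgeConjecture.Ring2AbelianAll.NonsplitGraphSurvival

open Matrix

variable {L : Type*} [Field L] {ι : Type*}

/-- **The survival equation applied twice.**  If `d′ b · X b a = d a · X a b` for all `a, b` (the graph of the identity
survives the direction `X` for plus-weights `d` and minus-weights `d′`), then every entry satisfies
`(d a · d b − d′ a · d′ b) · X a b = 0`: entries at positions where the weight products differ must vanish.
research route, not a corollary; conditional on HC_CM plus one named minimal statement. [locator LIMITS-G25 §3.4 (G)] -/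
theorem weightDefect_mul_entry_eq_zero (d d' : ι → L) (X : Matrix ι ι L)
    (h : ∀ a b, d' b * X b a = d a * X a b) (a b : ι) :
    (d a * d b - d' a * d' b) * X a b = 0 := by
  have h₁ := h a b
  have h₂ := h b a
  linear_combination -(d b) * h₁ - (d' b) * h₂

/-- **The cell (`d₊ = (1,1,1)`, `d₋ = (1,1,2)`): `Γ_I` survives exactly a 3-dimensional space of directions.**
Over a field of characteristic zero, `X` satisfies the survival equation `d′ b · X b a = X a b` (all `a, b`) iff its
third row and third column vanish and its `{0,1}`-block is symmetric.
research route, not a corollary; conditional on HC_CM plus one named minimal statement. [locator LIMITS-G25 §3.4 (G), engine row «cell Γ_I: 3»] -/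
theorem cell_graphSurvival_iff [CharZero L] (X : Matrix (Fin 3) (Fin 3) L) :
    (∀ a b : Fin 3, (![1, 1, 2] : Fin 3 → L) b * X b a = X a b) ↔
      (X 0 2 = 0 ∧ X 1 2 = 0 ∧ X 2 2 = 0 ∧ X 2 0 = 0 ∧ X 2 1 = 0 ∧ X 1 0 = X 0 1) := by
  constructor
  · intro h
    have key : ∀ a b : Fin 3, ((1 : L) * 1 - (![1, 1, 2] : Fin 3 → L) a * (![1, 1, 2] : Fin 3 → L) b) * X a b = 0 :=
      fun a b => weightDefect_mul_entry_eq_zero (fun _ => (1 : L)) ![1, 1, 2] X (by simpa using h) a b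
    have h02 := key 0 2
    have h12 := key 1 2
    have h22 := key 2 2
    have h20 := key 2 0
    have h21 := key 2 1
    have h10 := h 0 1
    simp only [Matrix.cons_val_zero, Matrix.cons_val_one, Matrix.head_cons, Matrix.cons_val_two,
      Matrix.tail_cons, one_mul, mul_one] at h02 h12 h22 h20 h21 h10
    norm_num at h02 h12 h22 h20 h21
    exact ⟨h02, h12, h22, h20, h21, h10⟩
  · rintro ⟨h02, h12, h22, h20, h21, h10⟩
    intro a b
    fin_cases a <;> fin_cases b <;> simp [h02, h12, h22, h20, h21, h10]

/-- **The split sibling (`d₊ = d₋ = (1,1,1)`): `Γ_I` survives exactly the symmetric directions** (dimension 6: the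
tangent space of the `X × X̂`-type locus through `E_ω⁶`, Markman's habitat).
research route, not a corollary; conditional on HC_CM plus one named minimal statement. [locator LIMITS-G25 §3.4 (G), engine row «split Γ_I: 6»] -/
theorem split_graphSurvival_iff (X : Matrix ι ι L) :
    (∀ a b : ι, (1 : L) * X b a = X a b) ↔ Xᵀ = X := by
  constructor
  · intro h
    ext a b
    simpa [Matrix.transpose_apply] using h a b
  · intro h a b
    have := congrFun (congrFun h a) b
    simpa [Matrix.transpose_apply] using this

end Summit.HodgeConjecture.Ring2AbelianAll.NonsplitGraphSurvival
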